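import Summits.BirchSwinnertonDyer.Rank1Residual.P2.CongruentNumberSilentEvenFiveGenusParity
import Summits.BirchSwinnertonDyer.Rank1Residual.P2.CongruentNumberSilentEvenFiveThetaDescentRankFamily
import Literature.NumberTheory.QuadraticFields.RedeiReichardtFourRank
import HarnessLib

/-!
# Cell «bsd-monsky» (prover-B): the Rédei–Reichardt binder GONE from route B's whole-family theorem —
# `BSD(E_{2pq}, 2)` for all `p ≡ 5 (mod 8)`, `q ≡ 3 (mod 4)` from {TYZ §3 data, GZK, `hMe`, the `θ`-display};
# and the genus parity `g(2pq) odd ⟺ q ≡ 3 (8) ∨ (p/q) = −1`, now unconditional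

HONEST FRAMING (cell `bsd-monsky`, run/shared/lean/pub/bsd-monsky/; README §1: ONE theorem on ONE explicit
infinite family of quadratic twists of the congruent number curve at the prime `2`; not "BSD for rank ≤ 1",
nothing at odd primes, nothing booked until the cross-family referee passes the written proof). Every door
here is CONDITIONAL on named hypotheses; the two conjecture `Prop`s of C-P2-1 stay `@[conjecture]`.

WHAT THIS FILE ADDS. The Literature named fact `redeiReichardt_fourTwoCard_classGroup` (Li–Ma 2008 Thm. 0.4) is
now a THEOREM of the tree: `RedeiReichardt.redeiReichardt_fourTwoCard_classGroup_holds`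
(`QuadraticFields/RedeiReichardtFourRank.lean`, seat «linnik», genus theory on ideals). Instantiating the binder `hR`:

* §1 `odd_gK_two_mul_five_mul_iff`: for primes `p ≡ 5 (mod 8)`, `q ≡ 3 (mod 4)`, `g(2pq)` is odd IFF `q ≡ 3 (mod 8)`
  or `(p/q) = −1` — BOTH directions unconditional (the ⟸ direction is also the genus-character theorem of
  `…GenusParity.lean` / `RedeiReichardtTwoPQ.lean`; the ⟹ direction — `g(2pq)` EVEN on `(p/q) = +1`, `q ≡ 7 (8)` —
  needs the principal genus theorem and comes from `_holds`); so on the even-five family route B's Theorem B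
  (hypothesis «`g(2pq)` odd») speaks to EXACTLY the rows `𝒮⁻ ∪ {q ≡ 3 (8)}` (PROOF-B §10, now a kernel statement:
  `not_odd_gK_two_mul_five_mul_of_jacobiSym_one_of_seven_mod_eight`).
* §2 `forall_bsdp_two_congruentNumberCurve_two_mul_five_mul_of_thetaDisplay_of_monskyEven (hTYZ hGZK hMe hΘ)`:
  `BSD(E_{2pq}, 2)` on the WHOLE even-five family from FOUR named inputs — TYZ §3 data (`hTYZ`) and GZK (`hGZK`) on
  the `(p/q) = +1` half (U⁺, TYZ Thm 1.2), Monsky's even `2`-Selmer matrix (`hMe`) for the Selmer rows, and route B's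
  `θ`-display (`hΘ`) on `𝒮⁻`; no Rédei–Reichardt, no `h515`, no Tian-2014 system. (The Aoki-1999 twin, with `hMe`
  replaced by `Aoki1999.thm22_card_selmerGroup_two`, is filed with route B's Aoki corner.)

Nothing booked; no mark moved.

References: [LiMa2008] Thm. 0.4; [Stevenhagen1995RedeiMatrices] §2; [TianYuanZhang2017] §1 (`g(d)`), Thm. 1.2, Thm. 3.5,
(1.1); [HeathBrown1994SelmerCongruentII] Appendix (Monsky) p. 41; [Miller2011LMS] Def. 1.1; HOME/proof/PROOF-B.md §10.
-/

noncomputable section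

open scoped Classical

open WeierstrassCurve NumberField Literature.NumberTheory.EllipticCurves
  Literature.NumberTheory.EllipticCurves.Rank1Residual
  Literature.NumberTheory.EllipticCurves.Rank1Residual.Typed
  Literature.NumberTheory.EllipticCurves.Monsky1990
  Literature.NumberTheory.EllipticCurves.HeathBrown1994
  Literature.NumberTheory.EllipticCurves.HeathBrown1994.Families
  Literature.NumberTheory.EllipticCurves.TianYuanZhang2017
  Literature.NumberTheory.QuadraticFields.RedeiReichardt

set_option autoImplicit false

namespace Summit.BirchSwinnertonDyer.Rank1Residual.P2

open ThetaDescent Conjectures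

/-! ## §1 The genus parity on the even-five family, both directions, unconditional -/

/-- **`g(2pq)` odd ⟺ `q ≡ 3 (mod 8)` or `(p/q) = −1`** for primes `p ≡ 5 (mod 8)`, `q ≡ 3 (mod 4)` — UNCONDITIONAL: the
tree's Rédei-matrix decision `odd_genusClassNumber_genusField_two_mul_five_mul_iff` with its binder instantiated by the
theorem `redeiReichardt_fourTwoCard_classGroup_holds`, and `kroneckerBit p q = 1 ⟺ (p/q) = −1`.
[cite: LiMa2008, Thm. 0.4 with Lemma 0.1] [cite: TianYuanZhang2017, §1 (p0002 L78–L82: g(d))] -/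
theorem odd_gK_two_mul_five_mul_iff {p q : ℕ} (hp : p.Prime) (hq : q.Prime) (hp5 : p % 8 = 5) (hq4 : q % 4 = 3) :
    Odd (gK (2 * (p * q))) ↔ (q % 8 = 3 ∨ jacobiSym p q = -1) := by
  have hq2 : q ≠ 2 := by omega
  have hne : p ≠ q := fun h => by omega
  have hbit := kroneckerBit_of_jacobiSym hp hq hq2 hne
  have h := odd_genusClassNumber_genusField_two_mul_five_mul_iff redeiReichardt_fourTwoCard_classGroup_holds
    hp hq hp5 hq4
  refine ⟨fun hodd => ?_, fun hc => ?_⟩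
  · rcases h.mp hodd with h3 | hk
    · exact Or.inl h3
    · right
      rcases jacobiSym.eq_one_or_neg_one (int_gcd_eq_one_of_primes hp hq hne) with hj | hj
      · rw [hbit.1 hj] at hk; exact absurd hk zero_ne_one
      · exact hj
  · rcases hc with h3 | hj
    · exact h.mpr (Or.inl h3)
    · exact h.mpr (Or.inr (hbit.2 hj))

/-- **`g(2pq)` is EVEN for `(p/q) = +1`, `q ≡ 7 (mod 8)`** (`p ≡ 5 (mod 8)`): the rows of the even-five family on which
route B's Theorem B is silent (PROOF-B §10; there TYZ's own `β`, i.e. the landed `𝒮⁺` theorem, decides). Unconditional.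
[cite: LiMa2008, Thm. 0.4 with Lemma 0.1] [cite: TianYuanZhang2017, §1 (p0002 L78–L82)] -/
theorem not_odd_gK_two_mul_five_mul_of_jacobiSym_one_of_seven_mod_eight {p q : ℕ} (hp : p.Prime) (hq : q.Prime)
    (hp5 : p % 8 = 5) (hq7 : q % 8 = 7) (hj : jacobiSym p q = 1) : ¬ Odd (gK (2 * (p * q))) := by
  intro hodd
  rcases (odd_gK_two_mul_five_mul_iff hp hq hp5 (by omega)).mp hodd with h3 | hm
  · omega
  · rw [hj] at hm; norm_num at hm

/-! ## §2 The whole even-five family without the Rédei–Reichardt binder -/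

/-- **`BSD(E_{2pq}, 2)` for ALL primes `p ≡ 5 (mod 8)`, `q ≡ 3 (mod 4)` from {`hTYZ`, `hGZK`, `hMe`, `hΘ`}** — route B's
whole-family theorem `…_of_thetaGenusPointDatum_of_monskyEven` with `hR := redeiReichardt_fourTwoCard_classGroup_holds`:
TYZ §3 data + GZK on `(p/q) = +1` (U⁺), the `θ`-display on `𝒮⁻`, Monsky's even matrix for every Selmer row. No
Rédei–Reichardt binder, no `h515`, no Tian-2014 system. CONDITIONAL on the four binders; nothing asserted.
[cite: TianYuanZhang2017, Thm. 1.2, Thm. 3.5 and §1 (1.1)] [cite: HeathBrown1994SelmerCongruentII, Appendix (Monsky) p. 41 L20–L36]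
[cite: Miller2011LMS, Def. 1.1 (arXiv:1010.2431 p. 3)] -/
theorem forall_bsdp_two_congruentNumberCurve_two_mul_five_mul_of_thetaDisplay_of_monskyEven
    (hTYZ : tyz_genusPointData) (hGZK : rank_eq_analyticRank_of_analyticRank_le_one)
    (hMe : monsky_card_selmerGroup_two_even)
    (hΘ : ∀ p q : ℕ, p.Prime → q.Prime → p % 8 = 5 → q % 4 = 3 → thetaGenusPointDatum p q) :
    ∀ p q : ℕ, p.Prime → q.Prime → p % 8 = 5 → q % 4 = 3 →
      BSDp (congruentNumberCurve (2 * (p * q))) 2 :=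
  forall_bsdp_two_congruentNumberCurve_two_mul_five_mul_of_conjecture_of_monskyEven hTYZ hGZK
    redeiReichardt_fourTwoCard_classGroup_holds hMe (congruentSilentEvenFiveBSDTwo_of_thetaDisplay_of_monskyEven hΘ hMe)

/-- **The same from the CM-level display** {`hTYZ`, `hGZK`, `hMe`, `thetaCMDatum` (D1)–(D7)}. CONDITIONAL; nothing
asserted. [cite: TianYuanZhang2017, Thm. 1.2, Prop. 3.2 (2), Thm. 3.6 (1)(2), Lemma 3.18, Thm. 3.5]
[cite: HeathBrown1994SelmerCongruentII, Appendix (Monsky) p. 41 L20–L36] -/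
theorem forall_bsdp_two_congruentNumberCurve_two_mul_five_mul_of_thetaCMDatum_of_monskyEven
    (hTYZ : tyz_genusPointData) (hGZK : rank_eq_analyticRank_of_analyticRank_le_one)
    (hMe : monsky_card_selmerGroup_two_even)
    (hΘ : ∀ p q : ℕ, p.Prime → q.Prime → p % 8 = 5 → q % 4 = 3 → thetaCMDatum p q) :
    ∀ p q : ℕ, p.Prime → q.Prime → p % 8 = 5 → q % 4 = 3 →
      BSDp (congruentNumberCurve (2 * (p * q))) 2 :=
  forall_bsdp_two_congruentNumberCurve_two_mul_five_mul_of_thetaDisplay_of_monskyEven hTYZ hGZK hMe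
    (fun p q hp hq hp5 hq4 => thetaGenusPointDatum_of_thetaCMDatum hp hq (hΘ p q hp hq hp5 hq4))

end Summit.BirchSwinnertonDyer.Rank1Residual.P2

end
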